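import Literature.MathematicalPhysics.QuantumFieldTheory.Balaban1983to89.B4Eq19LatticeDirichletReplacement
import Literature.MathematicalPhysics.QuantumFieldTheory.Balaban1983to89.B4Eq19LatticeBoxMeans

/-!
# `Balaban1983to89.B4Eq19LatticeDirichletZero` — T. Bałaban, *Propagators and renormalization transformations for lattice gauge theories. II*,
# Commun. Math. Phys. **96** (1984) 223–250 [Balaban1984PropagatorsII] (1.9) p. 226, with *Propagators for lattice gauge theories in a background
# field*, Commun. Math. Phys. **99** (1985) 389–434 [Balaban1985BackgroundPropagators] Thm 3.1 (3.43)₁∕(3.44) p. 398: **THE MASSLESS DIRICHLET PROBLEM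
# AND HARMONIC REPLACEMENT ON A BOX OF `ℤ^d`, AND ANTIDERIVATIVES ALONG ONE COORDINATE** (a mass term or any bounded source is divergence-form data in
# energy estimates) — inputs of the `C^{1,½}` (gradient) interior-regularity files `B4Eq19LatticeGradient*` ([Giaquinta1984] Ch. III §2–3, discrete).

statement-level skeleton of published theorems with citation tags; proofs where landed; nothing here is a claim about the Yang–Mills mass gap

CITATION HEADER (lean-in-tree rule).  Audit cell `pub-balaban`, sub-cell `t4`, BINDER row NE9; filed by NE9 crux-team LEAF PROVER 01
(`b2b-balaban-t4-ne9-formalise-leaf-01`, gen 95; bears_on: R4/N22).  The CONTENT is [folklore] lattice calculus ([Giaquinta1984] Ch. III §2's Dirichlet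
replacement at zero mass); [Balaban1984PropagatorsII] (1.9) ∕ [Balaban1985BackgroundPropagators] (3.43)₁, (3.44) are the printed statements these files serve,
nothing of them is asserted here.  REUSED BY NAME: `B4Eq19LatticeOperators.sum_mul_lop_self` (energy identity), `B4Eq19LatticeDirichletReplacement.lop_add`,
`gradSq_le_of_support`, `dirichlet_energy_le` (which hold for `κ ≥ 0`), `B4Eq19LatticeBoxMeans.update_succ_eq_add_unitVec`.

WHAT IS PROVED (sorry-free; proof lane — 0 `def`; [folklore]).
* §1 `eq_zero_of_fdiff_eq_zero`, **`exists_dirichlet_zero`**, **`exists_harmonic_replacement_zero`** — the MASSLESS (`κ = 0`, `d ≥ 1`) Dirichlet problem on a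
  box (injective by the energy identity: zero energy ⇒ constant along `e_0`-lines ⇒ zero by the zero boundary layer) and the harmonic replacement `u = h + w`,
  `−Δh = 0` on the box, `gradSq w ≤ Σ_{Q_{r+1}}|g|²` (gen 94's `exists_dirichlet` needs `κ > 0`; at `κ = 0` constants are harmonic, which the gradient
  excess decay of `B4Eq19LatticeGradientExcessDecay` uses).
* §2 **`exists_antideriv`** — on `Q_R(z)` every site function `f₀` with `|f₀| ≤ M` is a lattice divergence `∂*g₀` of a bond field along `e_0` with
  `|g₀(y,μ)| ≤ (2R+1)·M` on `Q_R(z)`.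
HONEST SCOPE.  [folklore] lemmas; no estimate of print; NOT summit progress (cell pub-balaban: NE9 NOT PRINTED ∕ NOT PROVED; spine PROVED 0∕9; finite T⁴ —
NOT infinite volume, NOT mass gap, NOT BetaPertH, NOT Clay).  NEW file importing `B4Eq19LatticeDirichletReplacement`, `B4Eq19LatticeBoxMeans`.  Net new
unproved facts: 0.
-/

noncomputable section

open scoped BigOperators
open Finset

namespace Literature.MathematicalPhysics.QuantumFieldTheory.Balaban1983to89.B4Eq19LatticeDirichletZero

open B4Eq19LatticeOperators B4Eq19LatticeDirichletReplacement B4Eq19LatticeBoxMeans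

variable {d : ℕ}

/-! ## §1 The massless Dirichlet problem on a box and the harmonic replacement -/

/-- `lop 0` kills constants. [folklore] [cite: Giaquinta1984, Ch. III §2 p.78] -/
theorem lop_zero_const (c : ℝ) (y : Zd d) : lop 0 (fun _ => c) y = 0 := by
  rw [lop_apply]; simp; ring

/-- Zero energy on `Q_{r+1}(z)` and zero values off `Q_r(z)` force zero values everywhere (walk along `e_0` to the boundary layer).
[folklore] [cite: Giaquinta1984, Ch. III §2 p.78] -/
theorem eq_zero_of_fdiff_eq_zero (hd : 0 < d) {w : Zd d → ℝ} {z : Zd d} {r : ℤ} (hw0 : ∀ y ∉ box z r, w y = 0)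
    (hfd : ∀ y ∈ box z r, fdiff ⟨0, hd⟩ w y = 0) : ∀ y, w y = 0 := by
  set j₀ : Fin d := ⟨0, hd⟩
  intro x
  by_cases hx : x ∈ box z r
  · have hxi := mem_box.1 hx
    -- walk from `x` along `e_0`
    have walk : ∀ n : ℕ, x j₀ + n ≤ z j₀ + r + 1 → w (Function.update x j₀ (x j₀ + n)) = w x := by
      intro n
      induction n with
      | zero => intro _; simp
      | succ n ih =>
        intro hn
        have hn' : x j₀ + n ≤ z j₀ + r := by push_cast at hn; linarith
        have hmem : Function.update x j₀ (x j₀ + n) ∈ box z r := by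
          rw [mem_box]; intro i
          by_cases h : i = j₀
          · rw [h]; simp only [Function.update_self]
            have := hxi j₀; rw [abs_le] at this ⊢; constructor <;> [linarith; linarith]
          · rw [Function.update_of_ne h]; exact hxi i
        have h0 := hfd _ hmem
        rw [fdiff_apply, sub_eq_zero, ← update_succ_eq_add_unitVec] at h0
        rw [← ih (by linarith)]
        push_cast; rw [← add_assoc]; exact h0
    obtain ⟨N, hN⟩ : ∃ N : ℕ, x j₀ + N = z j₀ + r + 1 :=
      ⟨(z j₀ + r + 1 - x j₀).toNat, by
        rw [Int.toNat_of_nonneg (by have := hxi j₀; rw [abs_le] at this; linarith)]; ring⟩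
    have hout : Function.update x j₀ (x j₀ + N) ∉ box z r := by
      rw [mem_box]; push Not; refine ⟨j₀, ?_⟩
      simp only [Function.update_self, hN]
      rw [show z j₀ + r + 1 - z j₀ = r + 1 by ring, abs_of_nonneg (by have := hxi j₀; have := abs_nonneg (x j₀ - z j₀); linarith)]
      linarith
    rw [← walk N hN.le, hw0 _ hout]
  · exact hw0 x hx

/-- **THE MASSLESS DIRICHLET PROBLEM ON A BOX** (`d ≥ 1`): every `ψ` has a `w : ℤ^d → ℝ` with `w = 0` off `Q_r(z)` and `−Δw = ψ` on `Q_r(z)` (the linear map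
`v ↦ (−Δ(ext v))|_{Q_r(z)}` is injective: `Σ v·(−Δ)v = gradSq = 0` forces constancy along `e_0`-lines, hence `v = 0` by the zero boundary layer).
[folklore] [cite: Giaquinta1984, Ch. III §2 p.78] -/
theorem exists_dirichlet_zero (hd : 0 < d) (z : Zd d) (r : ℤ) (ψ : Zd d → ℝ) :
    ∃ w : Zd d → ℝ, (∀ y ∉ box z r, w y = 0) ∧ (∀ y ∈ box z r, lop 0 w y = ψ y) := by
  classical
  set S : Finset (Zd d) := box z r with hS
  let ext : (S → ℝ) →ₗ[ℝ] (Zd d → ℝ) :=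
    { toFun := fun v y => if h : y ∈ S then v ⟨y, h⟩ else 0
      map_add' := fun v v' => by
        funext y; by_cases h : y ∈ S <;> simp [h]
      map_smul' := fun c v => by
        funext y; by_cases h : y ∈ S <;> simp [h] }
  have ext_apply_mem : ∀ (v : S → ℝ) (y : Zd d) (h : y ∈ S), ext v y = v ⟨y, h⟩ := fun v y h => by simp [ext, h]
  have ext_apply_not_mem : ∀ (v : S → ℝ) (y : Zd d), y ∉ S → ext v y = 0 := fun v y h => by simp [ext, h]
  let T : (S → ℝ) →ₗ[ℝ] (S → ℝ) :=
    { toFun := fun v x => lop 0 (ext v) x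
      map_add' := fun v v' => by
        funext x
        have : ext (v + v') = fun y => ext v y + ext v' y := by rw [map_add]; rfl
        rw [this, lop_add]; rfl
      map_smul' := fun c v => by
        funext x
        have : ext (c • v) = fun y => c * ext v y := by rw [map_smul]; rfl
        rw [this, lop_const_mul]; rfl }
  have T_apply : ∀ (v : S → ℝ) (x : S), T v x = lop 0 (ext v) x := fun v x => rfl
  have hinj : Function.Injective T := by
    rw [← LinearMap.ker_eq_bot, LinearMap.ker_eq_bot']
    intro v hv
    have hsupp : ∀ y ∉ box z (r + 1 - 1), ext v y = 0 := fun y hy => ext_apply_not_mem v y (by rwa [show r + 1 - 1 = r by ring] at hy)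
    have hE := sum_mul_lop_self 0 (ext v) z (r + 1) hsupp
    have hzero : ∑ y ∈ box z (r + 1), ext v y * lop 0 (ext v) y = 0 := by
      refine Finset.sum_eq_zero fun y _ => ?_
      by_cases hy : y ∈ S
      · have : lop 0 (ext v) y = T v ⟨y, hy⟩ := rfl
        rw [this, hv]; simp
      · rw [ext_apply_not_mem v y hy, zero_mul]
    have hG : gradSq (ext v) (box z (r + 1)) = 0 := by rw [hzero, zero_mul, add_zero] at hE; exact hE.symm
    have hfd : ∀ y ∈ box z r, fdiff ⟨0, hd⟩ (ext v) y = 0 := by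
      intro y hy
      have hy' : y ∈ box z (r + 1) := box_mono z (by linarith) hy
      rw [gradSq_def] at hG
      have h1 := (Finset.sum_eq_zero_iff_of_nonneg fun y _ => Finset.sum_nonneg fun μ _ => sq_nonneg (fdiff μ (ext v) y)).1 hG y hy'
      have h2 := (Finset.sum_eq_zero_iff_of_nonneg fun μ _ => sq_nonneg (fdiff μ (ext v) y)).1 h1 ⟨0, hd⟩ (Finset.mem_univ _)
      exact pow_eq_zero_iff (n := 2) (by norm_num) |>.1 h2
    have hall := eq_zero_of_fdiff_eq_zero hd (fun y hy => ext_apply_not_mem v y (by simpa [hS] using hy)) hfd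
    funext x
    have := hall x
    rw [ext_apply_mem v x x.2] at this
    simpa using this
  have hsurj : Function.Surjective T := LinearMap.surjective_of_injective hinj
  obtain ⟨v, hv⟩ := hsurj fun x => ψ x
  refine ⟨ext v, fun y hy => ext_apply_not_mem v y (by simpa [hS] using hy), fun y hy => ?_⟩
  have : T v ⟨y, by simpa [hS] using hy⟩ = ψ y := by rw [hv]
  rw [T_apply] at this
  exact this

/-- **MASSLESS HARMONIC REPLACEMENT ON A BOX** (`d ≥ 1`): for `−Δu = ∂*g` on `Q_r(z)` there are `h`, `w` with `u = h + w`, `w = 0` off `Q_r(z)`, `−Δh = 0` on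
`Q_r(z)`, and `gradSq w Q ≤ Σ_{y ∈ Q_{r+1}(z)} Σ_μ g(y,μ)²` for every finset `Q`. [folklore]
[cite: Giaquinta1984, Ch. III §2 pp.78–79; Balaban1984PropagatorsII, (1.9) p.226] -/
theorem exists_harmonic_replacement_zero (hd : 0 < d) (u : Zd d → ℝ) (g : Zd d → Fin d → ℝ) (z : Zd d) (r : ℤ)
    (hEq : ∀ y ∈ box z r, lop 0 u y = dvg g y) :
    ∃ h w : Zd d → ℝ, (∀ y, u y = h y + w y) ∧ (∀ y ∉ box z r, w y = 0) ∧ (∀ y ∈ box z r, lop 0 h y = 0) ∧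
      (∀ Q : Finset (Zd d), gradSq w Q ≤ ∑ y ∈ box z (r + 1), ∑ μ, g y μ ^ 2) := by
  obtain ⟨w, hw0, hw⟩ := exists_dirichlet_zero hd z r (dvg g)
  refine ⟨fun y => u y - w y, w, fun y => by ring, hw0, fun y hy => ?_, fun Q => ?_⟩
  · rw [lop_sub, hEq y hy, hw y hy, sub_self]
  · exact (gradSq_le_of_support hw0 Q).trans (dirichlet_energy_le le_rfl g hw0 hw)

/-! ## §2 Antiderivatives along one coordinate: every site function is a lattice divergence on a box -/

/-- Updating coordinate `j` forgets a previous shift along `e_j`. [folklore] [cite: Giaquinta1984, Ch. III §1 p.70] -/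
theorem update_sub_unitVec (y : Zd d) (j : Fin d) (t : ℤ) : Function.update (y - unitVec j) j t = Function.update y j t := by
  funext i
  by_cases h : i = j
  · subst h; simp
  · simp [Function.update_of_ne h, unitVec, Pi.single_eq_of_ne h]

/-- **ANTIDERIVATIVE ON A BOX** (`d ≥ 1`): if `|f₀| ≤ M` on `Q_R(z)` there is a bond field `g₀` (supported on the direction `e_0`) with `∂*g₀ = f₀` on `Q_R(z)`
and `|g₀(y, μ)| ≤ (2R+1)·M` on `Q_R(z)` (`g₀(y, e_0) = −Σ_{z_0 − R ≤ t ≤ y_0} f₀(y|_{y_0 := t})`).  Hence a mass term or any bounded source is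
divergence-form data in ENERGY estimates (Caccioppoli, Dirichlet energy), at the price of the factor `2R+1`. [folklore]
[cite: Giaquinta1984, Ch. III §2 p.79] -/
theorem exists_antideriv (hd : 0 < d) (f₀ : Zd d → ℝ) (z : Zd d) (R : ℤ) {M : ℝ} (hM : ∀ y ∈ box z R, |f₀ y| ≤ M) :
    ∃ g₀ : Zd d → Fin d → ℝ, (∀ y ∈ box z R, dvg g₀ y = f₀ y) ∧ (∀ y ∈ box z R, ∀ μ, |g₀ y μ| ≤ (2 * R + 1) * M) := by
  classical
  set j₀ : Fin d := ⟨0, hd⟩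
  set a : ℤ := z j₀ - R with ha
  set g₀ : Zd d → Fin d → ℝ := fun y μ =>
    if μ = j₀ then -∑ s ∈ Finset.range (y j₀ - a + 1).toNat, f₀ (Function.update y j₀ (a + s)) else 0 with hg₀
  -- points of the `e_0`-line through `y ∈ Q_R(z)` with coordinate `a + s`, `s ≤ 2R`, stay in `Q_R(z)`
  have hline : ∀ y ∈ box z R, ∀ s : ℕ, (s : ℤ) ≤ 2 * R → Function.update y j₀ (a + s) ∈ box z R := by
    intro y hy s hs
    rw [mem_box] at hy ⊢
    intro i
    by_cases h : i = j₀
    · subst h; simp only [Function.update_self, ha]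
      rw [abs_le]; constructor <;> [linarith; linarith]
    · rw [Function.update_of_ne h]; exact hy i
  refine ⟨g₀, fun y hy => ?_, fun y hy μ => ?_⟩
  · -- the divergence telescopes
    have hy0 : a ≤ y j₀ := by have := (mem_box.1 hy) j₀; rw [abs_le] at this; rw [ha]; linarith
    obtain ⟨n, hn⟩ : ∃ n : ℕ, y j₀ = a + n := ⟨(y j₀ - a).toNat, by rw [Int.toNat_of_nonneg (by linarith)]; ring⟩
    have hN1 : (y j₀ - a + 1).toNat = n + 1 := by
      rw [hn, show a + (n : ℤ) - a + 1 = ((n + 1 : ℕ) : ℤ) by push_cast; ring, Int.toNat_natCast]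
    have hN0 : ((y - unitVec j₀) j₀ - a + 1).toNat = n := by
      simp only [Pi.sub_apply, unitVec, Pi.single_eq_same, hn]
      rw [show a + (n : ℤ) - 1 - a + 1 = (n : ℤ) by ring, Int.toNat_natCast]
    have hother : ∀ μ, μ ≠ j₀ → g₀ (y - unitVec μ) μ - g₀ y μ = 0 := by
      intro μ hμ; simp only [hg₀, hμ, if_false, sub_self]
    rw [dvg_apply, ← Finset.sum_erase_add _ _ (Finset.mem_univ j₀), Finset.sum_eq_zero (fun μ hμ => hother μ (Finset.ne_of_mem_erase hμ)), zero_add]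
    simp only [hg₀, if_true, hN1, hN0, update_sub_unitVec, Finset.sum_range_succ]
    rw [← hn, Function.update_eq_self]; ring
  · have hR : 0 ≤ R := by have := (mem_box.1 hy) j₀; exact (abs_nonneg _).trans this
    have hMy : 0 ≤ M := (abs_nonneg _).trans (hM y hy)
    by_cases hμ : μ = j₀
    · simp only [hg₀, hμ, if_true, abs_neg]
      have hy0 : a ≤ y j₀ ∧ y j₀ ≤ z j₀ + R := by have := (mem_box.1 hy) j₀; rw [abs_le] at this; rw [ha]; constructor <;> linarith
      have hcnt : (((y j₀ - a + 1).toNat : ℕ) : ℝ) ≤ 2 * R + 1 := by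
        have h1 : ((y j₀ - a + 1).toNat : ℤ) = y j₀ - a + 1 := Int.toNat_of_nonneg (by linarith [hy0.1])
        have h2 : y j₀ - a + 1 ≤ 2 * R + 1 := by rw [ha]; linarith [hy0.2]
        have : (((y j₀ - a + 1).toNat : ℕ) : ℤ) ≤ 2 * R + 1 := by rw [h1]; exact h2
        exact_mod_cast this
      calc |∑ s ∈ Finset.range (y j₀ - a + 1).toNat, f₀ (Function.update y j₀ (a + s))|
          ≤ ∑ s ∈ Finset.range (y j₀ - a + 1).toNat, |f₀ (Function.update y j₀ (a + s))| := Finset.abs_sum_le_sum_abs _ _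
        _ ≤ ∑ s ∈ Finset.range (y j₀ - a + 1).toNat, M := Finset.sum_le_sum fun s hs => hM _ (hline y hy s (by
            have hs' := Finset.mem_range.1 hs
            have h1 : ((y j₀ - a + 1).toNat : ℤ) = y j₀ - a + 1 := Int.toNat_of_nonneg (by linarith [hy0.1])
            have : (s : ℤ) < y j₀ - a + 1 := by rw [← h1]; exact_mod_cast hs'
            rw [ha] at this; linarith [hy0.2]))
        _ = (((y j₀ - a + 1).toNat : ℕ) : ℝ) * M := by rw [Finset.sum_const, Finset.card_range, nsmul_eq_mul]
        _ ≤ (2 * R + 1) * M := mul_le_mul_of_nonneg_right hcnt hMy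
    · simp only [hg₀, hμ, if_false, abs_zero]
      have hR' : (0 : ℝ) ≤ R := by exact_mod_cast hR
      have : (0 : ℝ) ≤ 2 * R + 1 := by linarith
      exact mul_nonneg this hMy

end Literature.MathematicalPhysics.QuantumFieldTheory.Balaban1983to89.B4Eq19LatticeDirichletZero

end
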